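import Literature.Geometry.Lorentzian.TeukolskyWhitingRealAxis
import Literature.Geometry.Lorentzian.TeukolskyHorizonVanishing
import HarnessLib

/-!
# Mode stability for positive spin from negative spin: the Teukolsky–Starobinsky map in
# confluent-Heun form (Teixeira da Costa 2020, §4.3 via §2.3.2)

Part of the proof programme for the named fact
`Literature.Geometry.Lorentzian.Kerr.Costa2019_realAxisModeStability` (R. Teixeira da Costa,
Commun. Math. Phys. 378 (2020) 705–781 = arXiv:1910.02854 [Costa2019], Thm. 4.1). TdC §4.3: "we
can generate a nonzero solution to the radial ODE of opposite sign spin via the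
Teukolsky–Starobinsky identities … This contradicts the mode stability result for `s < 0`".
The radial Teukolsky–Starobinsky map `R ↦ Δ^s (𝒟₀⁺)^{2s} (Δ^s R)` (Prop. 2.14, Lemmas 2.16–2.17,
Kalnins–Miller–Williams) is, in the confluent-Heun normalisation `g = heunWeight · R` of
`TeukolskyRadialHeunForm.lean` (`𝒟₀⁺ = e^{−iΘ} ∂ᵣ e^{iΘ}`, `Θ' = K/Δ`), **plain differentiation**:
if `Δ g'' + P_s g' + Q_s g = 0` then `G = g^{(2s)}` solves `Δ G'' + P_{−s} G' + Q'_{−s} G = 0`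
with the angular parameter shifted `λ ↦ λ + 2s` (Leibniz: after `n` derivatives the coefficient
of `g^{(n−1)}` is `2γ n (n − 2s)`, which vanishes exactly at `n = 2s`;
`Costa2019.heun_iterate`, `Costa2019.heun_negSpin`). Hence
`R₋ = heunWeight(−s)⁻¹ g^{(2s)} = Δ^{2s} Σ_j (…) R^{(j)}` solves the spin `−s` radial ODE
(`Costa2019.isRadialTeukolskySolution_of_heun`), is outgoing at `𝓗⁺` (the smooth horizon
extension is differentiated; Lemma 2.19) and at `𝓘⁺` (the outgoing expansion is transported
through the ODE-reduced derivative chain, `Costa2019.outgoing_remainder_bounds_allSpin`, and the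
uniqueness of asymptotic coefficients; Prop. 2.14 / Lemma 2.19), so mode stability for spin
`−s < 0` gives `g^{(2s)} ≡ 0`; since `g → 0` at infinity (`|g| ≲ r^{2s} · r^{−2s−1}`), a
finite-difference induction gives `g ≡ 0`, i.e. `R ≡ 0` (`Costa2019.modeStability_pos_of_nonpos`).
Everything is proved; theorems only (D-0026).

## References
* R. Teixeira da Costa, CMP 378 (2020) 705–781, arXiv:1910.02854, Prop. 2.14, Lemmas 2.16–2.19,
  §4.3. [Costa2019]
* E. G. Kalnins, W. Miller, G. C. Williams, J. Math. Phys. 30 (1989) 2925–2929 (TS identities for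
  arbitrary spin; cited by [Costa2019] as the source of Lemmas 2.16–2.17).
-/

noncomputable section

open Complex Set Filter Topology

namespace Literature.Geometry.Lorentzian.Kerr

namespace Costa2019

/-! ### Iterated derivatives of smooth functions on an open set -/

/-- On an open set, all iterated derivatives of a smooth function are smooth, and each is the
derivative of the previous one. [folklore] -/
theorem iterate_deriv_smooth {φ : ℝ → ℂ} {U : Set ℝ} (hU : IsOpen U)
    (hφ : ContDiffOn ℝ ((⊤ : ℕ∞) : WithTop ℕ∞) φ U) (k : ℕ) :
    ContDiffOn ℝ ((⊤ : ℕ∞) : WithTop ℕ∞) (deriv^[k] φ) U ∧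
      ∀ r ∈ U, HasDerivAt (deriv^[k] φ) ((deriv^[k + 1] φ) r) r := by
  induction k with
  | zero =>
    refine ⟨hφ, fun r hr => ?_⟩
    rw [Function.iterate_succ_apply']
    exact ((hφ.differentiableOn (by simp)).differentiableAt (hU.mem_nhds hr)).hasDerivAt
  | succ k ih =>
    have h1 : ContDiffOn ℝ ((⊤ : ℕ∞) : WithTop ℕ∞) (deriv^[k + 1] φ) U := by
      rw [Function.iterate_succ_apply']
      exact ih.1.deriv_of_isOpen hU le_rfl
    refine ⟨h1, fun r hr => ?_⟩
    rw [Function.iterate_succ_apply' deriv (k + 1)]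
    exact ((h1.differentiableOn (by simp)).differentiableAt (hU.mem_nhds hr)).hasDerivAt

/-- Iterated derivatives are local: two functions agreeing on an open set have the same iterated
derivatives there. [folklore] -/
theorem iterate_deriv_eqOn {φ ψ : ℝ → ℂ} {U : Set ℝ} (hU : IsOpen U) (h : EqOn φ ψ U) (k : ℕ) :
    EqOn (deriv^[k] φ) (deriv^[k] ψ) U := by
  induction k with
  | zero => simpa using h
  | succ k ih =>
    intro r hr
    rw [Function.iterate_succ_apply', Function.iterate_succ_apply']
    have hloc : deriv^[k] φ =ᶠ[𝓝 r] deriv^[k] ψ := by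
      filter_upwards [hU.mem_nhds hr] with x hx using ih hx
    exact hloc.deriv_eq

/-- Iterated derivatives commute with translations. [folklore] -/
theorem iterate_deriv_comp_add_const (φ : ℝ → ℂ) (c : ℝ) (k : ℕ) :
    deriv^[k] (fun x => φ (x + c)) = fun x => (deriv^[k] φ) (x + c) := by
  induction k with
  | zero => rfl
  | succ k ih =>
    rw [Function.iterate_succ_apply', Function.iterate_succ_apply', ih]
    funext x
    exact deriv_comp_add_const _ c x

/-! ### A function with a vanishing iterated derivative which tends to zero vanishes -/

/-- **Finite-difference induction.** If `φ` is smooth on `(b, ∞)`, `φ^{(k)} ≡ 0` there and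
`φ → 0` at `+∞`, then `φ ≡ 0` on `(b, ∞)` (a polynomial tending to zero is zero; proved by
induction on `k` through the difference `φ(· + 1) − φ`, which has `(k−1)`-st derivative zero).
[folklore] -/
theorem eq_zero_of_iterate_deriv_eq_zero {b : ℝ} :
    ∀ (k : ℕ) {φ : ℝ → ℂ}, ContDiffOn ℝ ((⊤ : ℕ∞) : WithTop ℕ∞) φ (Ioi b) →
      (∀ r, b < r → (deriv^[k] φ) r = 0) → Tendsto φ atTop (𝓝 0) → ∀ r, b < r → φ r = 0 := by
  intro k
  induction k with
  | zero => intro φ _ h0 _ r hr; simpa using h0 r hr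
  | succ k ih =>
    intro φ hφ hk hlim r hr
    -- `φ^{(k)}` is constant on `(b, ∞)`
    obtain ⟨-, hDk'⟩ := iterate_deriv_smooth isOpen_Ioi hφ k
    have hconst : ∀ x, b < x → (deriv^[k] φ) (x + 1) = (deriv^[k] φ) x := by
      intro x hx
      have h := norm_image_sub_le_of_norm_deriv_le_segment' (f := deriv^[k] φ)
        (f' := deriv^[k + 1] φ) (a := x) (b := x + 1) (C := 0)
        (fun y hy => (hDk' y (show b < y by linarith [hy.1])).hasDerivWithinAt)
        (fun y hy => by rw [hk y (by linarith [hy.1]), norm_zero]) (x + 1) ⟨by linarith, le_rfl⟩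
      rw [zero_mul, norm_le_zero_iff, sub_eq_zero] at h
      exact h
    -- the finite difference
    set δ : ℝ → ℂ := fun x => φ (x + 1) - φ x with hδ
    have hδs : ContDiffOn ℝ ((⊤ : ℕ∞) : WithTop ℕ∞) δ (Ioi b) := by
      refine ContDiffOn.sub ?_ hφ
      exact hφ.comp (contDiff_id.add contDiff_const).contDiffOn fun x hx =>
        show b < x + 1 by linarith [mem_Ioi.1 hx]
    have key : ∀ j, ∀ x, b < x → (deriv^[j] δ) x = (deriv^[j] φ) (x + 1) - (deriv^[j] φ) x := by
      intro j
      induction j with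
      | zero => intro x _; rfl
      | succ j ihj =>
        intro x hx
        rw [Function.iterate_succ_apply']
        have hloc : deriv^[j] δ =ᶠ[𝓝 x] fun y => (deriv^[j] φ) (y + 1) - (deriv^[j] φ) y := by
          filter_upwards [Ioi_mem_nhds hx] with y hy using ihj y hy
        rw [hloc.deriv_eq]
        obtain ⟨-, hDj⟩ := iterate_deriv_smooth isOpen_Ioi hφ j
        have h1 : HasDerivAt (fun y => (deriv^[j] φ) (y + 1)) ((deriv^[j + 1] φ) (x + 1)) x :=
          (hDj (x + 1) (show b < x + 1 by linarith)).comp_add_const x 1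
        have h2 := hDj x hx
        have h3 : HasDerivAt (fun y => (deriv^[j] φ) (y + 1) - (deriv^[j] φ) y)
            ((deriv^[j + 1] φ) (x + 1) - (deriv^[j + 1] φ) x) x := h1.sub h2
        rw [h3.deriv]
    have hδk : ∀ x, b < x → (deriv^[k] δ) x = 0 := by
      intro x hx
      rw [key k x hx, hconst x hx, sub_self]
    have hδlim : Tendsto δ atTop (𝓝 0) := by
      have h1 : Tendsto (fun x => φ (x + 1)) atTop (𝓝 0) :=
        hlim.comp (tendsto_atTop_add_const_right _ 1 tendsto_id)
      have := h1.sub hlim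
      rw [sub_zero] at this
      exact this
    have hδ0 := ih hδs hδk hδlim
    -- periodicity and decay
    have hper : ∀ n : ℕ, φ (r + n) = φ r := by
      intro n
      induction n with
      | zero => simp
      | succ n ihn =>
        have hpos : (0 : ℝ) ≤ n := Nat.cast_nonneg n
        have := hδ0 (r + n) (by linarith)
        simp only [hδ, sub_eq_zero] at this
        rw [Nat.cast_succ, ← add_assoc, this, ihn]
    have h1 : Tendsto (fun n : ℕ => φ (r + n)) atTop (𝓝 0) :=
      hlim.comp (tendsto_atTop_add_const_left atTop r tendsto_natCast_atTop_atTop)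
    have h2 : Tendsto (fun n : ℕ => φ (r + n)) atTop (𝓝 (φ r)) := by
      simp only [hper]; exact tendsto_const_nhds
    exact tendsto_nhds_unique h2 h1

/-! ### Asymptotic expansions in pure powers: uniqueness of coefficients -/

/-- A complex number bounded by `B/r` for all large `r` vanishes. [folklore] -/
theorem eq_zero_of_norm_le_div {z : ℂ} {B X : ℝ} (h : ∀ r, X ≤ r → ‖z‖ ≤ B / r) : z = 0 := by
  have hlim : Tendsto (fun r : ℝ => B / r) atTop (𝓝 0) := tendsto_const_nhds.div_atTop tendsto_id
  have hle : ‖z‖ ≤ 0 :=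
    le_of_tendsto_of_tendsto tendsto_const_nhds hlim
      (Filter.eventually_atTop.2 ⟨X, fun r hr => h r hr⟩)
  exact norm_le_zero_iff.1 hle

/-- **Uniqueness of asymptotic coefficients.** If `Σ_{k≤K} bₖ r^{d−k} = O(r^{d−K−1})` as
`r → ∞`, then all `bₖ` vanish. [folklore] -/
theorem coeff_eq_zero_of_expansion :
    ∀ (K : ℕ) {d : ℤ} {b : ℕ → ℂ} {C X : ℝ},
      (∀ r : ℝ, X ≤ r → ‖∑ k ∈ Finset.range (K + 1), b k * (r : ℂ) ^ (d - k)‖ ≤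
        C * r ^ (d - K - 1 : ℤ)) → ∀ k, k ≤ K → b k = 0 := by
  intro K
  induction K with
  | zero =>
    intro d b C X h k hk
    rw [Nat.le_zero.1 hk]
    refine eq_zero_of_norm_le_div (B := |C|) (X := max X 1) fun r hr => ?_
    have hr1 : 1 ≤ r := (le_max_right _ _).trans hr
    have hr0 : 0 < r := by linarith
    have h1 := h r ((le_max_left _ _).trans hr)
    simp only [zero_add, Finset.range_one, Finset.sum_singleton, Nat.cast_zero, sub_zero] at h1
    rw [norm_mul, Complex.norm_zpow, Complex.norm_real, Real.norm_eq_abs, abs_of_pos hr0] at h1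
    have hzd : 0 < r ^ d := zpow_pos hr0 d
    have h2 : ‖b 0‖ ≤ C * r ^ (d - 1 : ℤ) / r ^ d := by rw [le_div_iff₀ hzd]; exact h1
    calc ‖b 0‖ ≤ C * r ^ (d - 1 : ℤ) / r ^ d := h2
      _ = C / r := by
          rw [zpow_sub_one₀ hr0.ne']
          field_simp
      _ ≤ |C| / r := div_le_div_of_nonneg_right (le_abs_self C) hr0.le
  | succ K ih =>
    intro d b C X h
    -- the leading coefficient vanishes
    set S : ℝ := ∑ k ∈ Finset.range (K + 1 + 1), ‖b k‖ with hS
    have hS0 : 0 ≤ S := Finset.sum_nonneg fun k _ => norm_nonneg _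
    have hb0 : b 0 = 0 := by
      refine eq_zero_of_norm_le_div (B := |C| + S) (X := max X 1) fun r hr => ?_
      have hr1 : 1 ≤ r := (le_max_right _ _).trans hr
      have hr0 : 0 < r := by linarith
      have h1 := h r ((le_max_left _ _).trans hr)
      rw [Finset.sum_range_succ'] at h1
      simp only [Nat.cast_zero, sub_zero, Nat.cast_succ] at h1
      -- the tail is `O(r^{d−1})`
      have htail : ‖∑ k ∈ Finset.range (K + 1), b (k + 1) * (r : ℂ) ^ (d - ((k : ℤ) + 1))‖ ≤
          S * r ^ (d - 1) := by
        calc _ ≤ ∑ k ∈ Finset.range (K + 1), ‖b (k + 1) * (r : ℂ) ^ (d - ((k : ℤ) + 1))‖ :=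
              norm_sum_le _ _
          _ ≤ ∑ k ∈ Finset.range (K + 1), ‖b (k + 1)‖ * r ^ (d - 1) := by
              refine Finset.sum_le_sum fun k _ => ?_
              rw [norm_mul, Complex.norm_zpow, Complex.norm_real, Real.norm_eq_abs, abs_of_pos hr0]
              exact mul_le_mul_of_nonneg_left (zpow_le_zpow_right₀ hr1 (by omega)) (norm_nonneg _)
          _ = (∑ k ∈ Finset.range (K + 1), ‖b (k + 1)‖) * r ^ (d - 1) := by rw [Finset.sum_mul]
          _ ≤ S * r ^ (d - 1) := by
              refine mul_le_mul_of_nonneg_right ?_ (zpow_nonneg hr0.le _)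
              have e := Finset.sum_range_succ' (fun k => ‖b k‖) (K + 1)
              rw [hS]
              linarith [e, norm_nonneg (b 0)]
      have hmain : ‖b 0 * (r : ℂ) ^ d‖ ≤ (|C| + S) * r ^ (d - 1) := by
        have e : b 0 * (r : ℂ) ^ d = (∑ k ∈ Finset.range (K + 1), b (k + 1) * (r : ℂ) ^ (d - ((k : ℤ) + 1)) +
            b 0 * (r : ℂ) ^ d) - ∑ k ∈ Finset.range (K + 1), b (k + 1) * (r : ℂ) ^ (d - ((k : ℤ) + 1)) := by
          ring
        rw [e]
        refine (norm_sub_le _ _).trans ?_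
        have hC' : C * r ^ (d - ((K : ℤ) + 1) - 1) ≤ |C| * r ^ (d - 1) :=
          (mul_le_mul_of_nonneg_right (le_abs_self C) (zpow_nonneg hr0.le _)).trans
            (mul_le_mul_of_nonneg_left (zpow_le_zpow_right₀ hr1 (by omega)) (abs_nonneg C))
        calc _ ≤ C * r ^ (d - ((K : ℤ) + 1) - 1) + S * r ^ (d - 1) := add_le_add h1 htail
          _ ≤ |C| * r ^ (d - 1) + S * r ^ (d - 1) := add_le_add hC' le_rfl
          _ = (|C| + S) * r ^ (d - 1) := by ring
      rw [norm_mul, Complex.norm_zpow, Complex.norm_real, Real.norm_eq_abs, abs_of_pos hr0] at hmain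
      have hzd : 0 < r ^ d := zpow_pos hr0 d
      calc ‖b 0‖ ≤ (|C| + S) * r ^ (d - 1) / r ^ d := by rw [le_div_iff₀ hzd]; exact hmain
        _ = (|C| + S) / r := by rw [zpow_sub_one₀ hr0.ne']; field_simp
    -- the remaining coefficients by induction (degree `d − 1`)
    have h' : ∀ r : ℝ, X ≤ r → ‖∑ k ∈ Finset.range (K + 1), (fun k => b (k + 1)) k * (r : ℂ) ^ ((d - 1) - k)‖ ≤
        C * r ^ ((d - 1) - K - 1 : ℤ) := by
      intro r hr
      have h1 := h r hr
      rw [Finset.sum_range_succ', hb0, zero_mul, add_zero] at h1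
      have e : ∀ k : ℕ, (d - ((k + 1 : ℕ) : ℤ) : ℤ) = (d - 1) - k := fun k => by push_cast; ring
      simp only [e] at h1
      exact h1
    intro k hk
    rcases k with _ | k
    · exact hb0
    · exact ih h' k (by omega)

/-- **Diagonal choice of coefficients.** If for every order `J` the function `F` admits SOME
expansion `F = Φ₀ Σ_{k≤J} b_k^{(J)} r^{d−k} + O(r^{d−J−1})` (`|Φ₀| = 1`), then one coefficient
sequence serves all orders (uniqueness of asymptotic coefficients). [folklore] -/
theorem exists_uniform_coeffs {F Φ₀ : ℝ → ℂ} (hΦ : ∀ r, ‖Φ₀ r‖ = 1) {d : ℤ}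
    (h : ∀ J : ℕ, ∃ (b : ℕ → ℂ) (C X : ℝ), ∀ r, X ≤ r →
      ‖F r - Φ₀ r * ∑ k ∈ Finset.range (J + 1), b k * (r : ℂ) ^ (d - k)‖ ≤ C * r ^ (d - J - 1 : ℤ)) :
    ∃ c : ℕ → ℂ, ∀ J : ℕ, ∃ C X : ℝ, ∀ r, X ≤ r →
      ‖F r - Φ₀ r * ∑ k ∈ Finset.range (J + 1), c k * (r : ℂ) ^ (d - k)‖ ≤ C * r ^ (d - J - 1 : ℤ) := by
  choose B CB XB hB using h
  -- truncation: an order-`J` expansion is an order-`k` expansion for `k ≤ J`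
  have htrunc : ∀ J k, k ≤ J → ∃ C X : ℝ, ∀ r, X ≤ r →
      ‖F r - Φ₀ r * ∑ i ∈ Finset.range (k + 1), B J i * (r : ℂ) ^ (d - i)‖ ≤ C * r ^ (d - k - 1 : ℤ) := by
    intro J k hkJ
    set S : ℝ := ∑ i ∈ Finset.range (J + 1), ‖B J i‖ with hS
    have hS0 : 0 ≤ S := Finset.sum_nonneg fun i _ => norm_nonneg _
    refine ⟨|CB J| + S, max (XB J) 1, fun r hr => ?_⟩
    have hr1 : 1 ≤ r := (le_max_right _ _).trans hr
    have hr0 : 0 < r := by linarith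
    have h1 := hB J r ((le_max_left _ _).trans hr)
    -- split the sum
    have hsplit : ∑ i ∈ Finset.range (J + 1), B J i * (r : ℂ) ^ (d - i) =
        ∑ i ∈ Finset.range (k + 1), B J i * (r : ℂ) ^ (d - i) +
          ∑ i ∈ Finset.Ico (k + 1) (J + 1), B J i * (r : ℂ) ^ (d - i) := by
      rw [Finset.range_eq_Ico, Finset.range_eq_Ico]
      exact (Finset.sum_Ico_consecutive _ (Nat.zero_le _) (by omega)).symm
    have htail : ‖Φ₀ r * ∑ i ∈ Finset.Ico (k + 1) (J + 1), B J i * (r : ℂ) ^ (d - i)‖ ≤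
        S * r ^ (d - k - 1 : ℤ) := by
      rw [norm_mul, hΦ r, one_mul]
      calc _ ≤ ∑ i ∈ Finset.Ico (k + 1) (J + 1), ‖B J i * (r : ℂ) ^ (d - i)‖ := norm_sum_le _ _
        _ ≤ ∑ i ∈ Finset.Ico (k + 1) (J + 1), ‖B J i‖ * r ^ (d - k - 1 : ℤ) := by
            refine Finset.sum_le_sum fun i hi => ?_
            have hik : k + 1 ≤ i := (Finset.mem_Ico.1 hi).1
            rw [norm_mul, Complex.norm_zpow, Complex.norm_real, Real.norm_eq_abs, abs_of_pos hr0]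
            exact mul_le_mul_of_nonneg_left (zpow_le_zpow_right₀ hr1 (by omega)) (norm_nonneg _)
        _ = (∑ i ∈ Finset.Ico (k + 1) (J + 1), ‖B J i‖) * r ^ (d - k - 1 : ℤ) := by
            rw [Finset.sum_mul]
        _ ≤ S * r ^ (d - k - 1 : ℤ) := by
            refine mul_le_mul_of_nonneg_right ?_ (zpow_nonneg hr0.le _)
            rw [hS]
            exact Finset.sum_le_sum_of_subset_of_nonneg
              (fun i hi => Finset.mem_range.2 (Finset.mem_Ico.1 hi).2) fun i _ _ => norm_nonneg _
    have e : F r - Φ₀ r * ∑ i ∈ Finset.range (k + 1), B J i * (r : ℂ) ^ (d - i) =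
        (F r - Φ₀ r * ∑ i ∈ Finset.range (J + 1), B J i * (r : ℂ) ^ (d - i)) +
          Φ₀ r * ∑ i ∈ Finset.Ico (k + 1) (J + 1), B J i * (r : ℂ) ^ (d - i) := by
      rw [hsplit]; ring
    rw [e]
    have hC' : CB J * r ^ (d - J - 1 : ℤ) ≤ |CB J| * r ^ (d - k - 1 : ℤ) :=
      (mul_le_mul_of_nonneg_right (le_abs_self _) (zpow_nonneg hr0.le _)).trans
        (mul_le_mul_of_nonneg_left (zpow_le_zpow_right₀ hr1 (by omega)) (abs_nonneg _))
    calc _ ≤ CB J * r ^ (d - J - 1 : ℤ) + S * r ^ (d - k - 1 : ℤ) :=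
          (norm_add_le _ _).trans (add_le_add h1 htail)
      _ ≤ |CB J| * r ^ (d - k - 1 : ℤ) + S * r ^ (d - k - 1 : ℤ) := add_le_add hC' le_rfl
      _ = (|CB J| + S) * r ^ (d - k - 1 : ℤ) := by ring
  -- consistency of the coefficients
  have hcons : ∀ J k, k ≤ J → B J k = B k k := by
    intro J k hkJ
    obtain ⟨C₁, X₁, h₁⟩ := htrunc J k hkJ
    obtain ⟨C₂, X₂, h₂⟩ := htrunc k k le_rfl
    have hdiff : ∀ r, max X₁ X₂ ≤ r →
        ‖∑ i ∈ Finset.range (k + 1), (fun i => B J i - B k i) i * (r : ℂ) ^ (d - i)‖ ≤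
          (C₁ + C₂) * r ^ (d - k - 1 : ℤ) := by
      intro r hr
      have e1 := h₁ r ((le_max_left _ _).trans hr)
      have e2 := h₂ r ((le_max_right _ _).trans hr)
      have e : ∑ i ∈ Finset.range (k + 1), (fun i => B J i - B k i) i * (r : ℂ) ^ (d - i) =
          ∑ i ∈ Finset.range (k + 1), B J i * (r : ℂ) ^ (d - i) -
            ∑ i ∈ Finset.range (k + 1), B k i * (r : ℂ) ^ (d - i) := by
        rw [← Finset.sum_sub_distrib]
        refine Finset.sum_congr rfl fun i _ => ?_
        ring
      have hΦ0 : Φ₀ r ≠ 0 := fun h0 => by have := hΦ r; rw [h0, norm_zero] at this; exact one_ne_zero this.symm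
      have e' : ∑ i ∈ Finset.range (k + 1), B J i * (r : ℂ) ^ (d - i) -
          ∑ i ∈ Finset.range (k + 1), B k i * (r : ℂ) ^ (d - i) =
          (Φ₀ r)⁻¹ * ((F r - Φ₀ r * ∑ i ∈ Finset.range (k + 1), B k i * (r : ℂ) ^ (d - i)) -
            (F r - Φ₀ r * ∑ i ∈ Finset.range (k + 1), B J i * (r : ℂ) ^ (d - i))) := by
        field_simp
        ring
      rw [e, e', norm_mul, norm_inv, hΦ r, inv_one, one_mul]
      calc _ ≤ _ := norm_sub_le _ _
        _ ≤ C₂ * r ^ (d - k - 1 : ℤ) + C₁ * r ^ (d - k - 1 : ℤ) := add_le_add e2 e1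
        _ = (C₁ + C₂) * r ^ (d - k - 1 : ℤ) := by ring
    have := coeff_eq_zero_of_expansion k hdiff k le_rfl
    exact sub_eq_zero.1 this
  refine ⟨fun k => B k k, fun J => ⟨CB J, XB J, fun r hr => ?_⟩⟩
  have e : ∑ k ∈ Finset.range (J + 1), B k k * (r : ℂ) ^ (d - k) =
      ∑ k ∈ Finset.range (J + 1), B J k * (r : ℂ) ^ (d - k) :=
    Finset.sum_congr rfl fun k hk => by rw [hcons J k (Nat.lt_succ_iff.1 (Finset.mem_range.1 hk))]
  rw [e]
  exact hB J r hr

/-- **Expansion of a symbol with a single coefficient sequence** (the Taylor coefficients of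
`G` at `u = 0`): for `g ∈ IsInvSmooth r₁ d`, `g = Σ_{j≤J} aⱼ r^{d−j} + O(r^{d−J−1})` for every
`J`, with `a` independent of `J`. [folklore] -/
theorem IsInvSmooth.expansion' {r₁ : ℝ} {d : ℤ} {g : ℝ → ℂ} (hr₁ : 0 < r₁) (h : IsInvSmooth r₁ d g) :
    ∃ a : ℕ → ℂ, ∀ J : ℕ, ∃ C : ℝ, ∀ r, r₁ < r →
      ‖g r - ∑ j ∈ Finset.range (J + 1), a j * (r : ℂ) ^ (d - j)‖ ≤ C * r ^ (d - J - 1 : ℤ) := by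
  obtain ⟨G, hG, hg⟩ := h
  have hU : UniqueDiffOn ℝ (Icc (0 : ℝ) r₁⁻¹) := uniqueDiffOn_Icc (inv_pos.2 hr₁)
  set a : ℕ → ℂ := fun j => (((Nat.factorial j : ℝ)⁻¹ : ℝ) : ℂ) *
    iteratedDerivWithin j G (Icc 0 r₁⁻¹) 0 with ha
  refine ⟨a, fun J => ?_⟩
  have hGJ : ContDiffOn ℝ (J + 1) G (Icc 0 r₁⁻¹) := hG.of_le (by exact_mod_cast le_top)
  have hcont : ContinuousOn (iteratedDerivWithin (J + 1) G (Icc 0 r₁⁻¹)) (Icc 0 r₁⁻¹) :=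
    hGJ.continuousOn_iteratedDerivWithin (by exact_mod_cast le_rfl) hU
  obtain ⟨C₀, hC₀⟩ := isCompact_Icc.exists_bound_of_continuousOn hcont
  refine ⟨C₀ / Nat.factorial J, fun r hr => ?_⟩
  have hr0 : 0 < r := hr₁.trans hr
  have hu := IsInvSmooth.inv_mem hr₁ hr
  have htaylor := taylor_mean_remainder_bound (inv_pos.2 hr₁).le hGJ hu hC₀
  have heq : taylorWithinEval G J (Icc 0 r₁⁻¹) 0 r⁻¹ =
      ∑ j ∈ Finset.range (J + 1), a j * (r⁻¹ : ℂ) ^ j := by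
    rw [taylor_within_apply]
    refine Finset.sum_congr rfl fun j _ => ?_
    rw [sub_zero, Complex.real_smul, ha]
    push_cast
    ring
  rw [heq] at htaylor
  have hrc : (r : ℂ) ≠ 0 := by exact_mod_cast hr0.ne'
  have hsum : ∑ j ∈ Finset.range (J + 1), a j * (r : ℂ) ^ (d - j) =
      (r : ℂ) ^ d * ∑ j ∈ Finset.range (J + 1), a j * (r⁻¹ : ℂ) ^ j := by
    rw [Finset.mul_sum]
    refine Finset.sum_congr rfl fun j _ => ?_
    rw [zpow_sub₀ hrc, zpow_natCast, inv_pow]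
    field_simp
  rw [hg r hr, hsum, ← mul_sub, norm_mul, Complex.norm_zpow, Complex.norm_real, Real.norm_eq_abs,
    abs_of_pos hr0]
  calc r ^ d * ‖G r⁻¹ - ∑ j ∈ Finset.range (J + 1), a j * (r⁻¹ : ℂ) ^ j‖ ≤
      r ^ d * (C₀ * (r⁻¹ - 0) ^ (J + 1) / Nat.factorial J) :=
        mul_le_mul_of_nonneg_left htaylor (zpow_nonneg hr0.le _)
    _ = C₀ / Nat.factorial J * r ^ (d - J - 1 : ℤ) := by
        rw [sub_zero, show (d - J - 1 : ℤ) = d + (-(J + 1 : ℕ) : ℤ) by push_cast; ring,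
          zpow_add₀ hr0.ne', zpow_neg, zpow_natCast, inv_pow]
        ring

/-! ### The derivative closure of the confluent Heun equation (Leibniz) -/

/-- Differentiating a three-term identity on an open set. [folklore] -/
theorem deriv_identity3 {U : Set ℝ} (hU : IsOpen U) {u₀ u₁ u₂ u₃ A B C A' B' C' : ℝ → ℂ}
    (h0 : ∀ r ∈ U, HasDerivAt u₀ (u₁ r) r) (h1 : ∀ r ∈ U, HasDerivAt u₁ (u₂ r) r)
    (h2 : ∀ r ∈ U, HasDerivAt u₂ (u₃ r) r)
    (hA : ∀ r ∈ U, HasDerivAt A (A' r) r) (hB : ∀ r ∈ U, HasDerivAt B (B' r) r)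
    (hC : ∀ r ∈ U, HasDerivAt C (C' r) r)
    (hid : ∀ r ∈ U, A r * u₂ r + B r * u₁ r + C r * u₀ r = 0) :
    ∀ r ∈ U, A r * u₃ r + (A' r + B r) * u₂ r + (B' r + C r) * u₁ r + C' r * u₀ r = 0 := by
  intro r hr
  have hH : HasDerivAt (fun x => A x * u₂ x + B x * u₁ x + C x * u₀ x)
      (A' r * u₂ r + A r * u₃ r + (B' r * u₁ r + B r * u₂ r) + (C' r * u₀ r + C r * u₁ r)) r :=
    (((hA r hr).mul (h2 r hr)).add ((hB r hr).mul (h1 r hr))).add ((hC r hr).mul (h0 r hr))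
  have hzero : HasDerivAt (fun x => A x * u₂ x + B x * u₁ x + C x * u₀ x) 0 r := by
    refine (hasDerivAt_const r (0 : ℂ)).congr_of_eventuallyEq ?_
    filter_upwards [hU.mem_nhds hr] with x hx using hid x hx
  have := hH.unique hzero
  linear_combination this

/-- Differentiating a four-term identity (last coefficient constant) on an open set. [folklore] -/
theorem deriv_identity4 {U : Set ℝ} (hU : IsOpen U) {u₀ u₁ u₂ u₃ u₄ A B C A' B' C' : ℝ → ℂ} {E : ℂ}
    (h0 : ∀ r ∈ U, HasDerivAt u₀ (u₁ r) r) (h1 : ∀ r ∈ U, HasDerivAt u₁ (u₂ r) r)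
    (h2 : ∀ r ∈ U, HasDerivAt u₂ (u₃ r) r) (h3 : ∀ r ∈ U, HasDerivAt u₃ (u₄ r) r)
    (hA : ∀ r ∈ U, HasDerivAt A (A' r) r) (hB : ∀ r ∈ U, HasDerivAt B (B' r) r)
    (hC : ∀ r ∈ U, HasDerivAt C (C' r) r)
    (hid : ∀ r ∈ U, A r * u₃ r + B r * u₂ r + C r * u₁ r + E * u₀ r = 0) :
    ∀ r ∈ U, A r * u₄ r + (A' r + B r) * u₃ r + (B' r + C r) * u₂ r + (C' r + E) * u₁ r = 0 := by
  intro r hr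
  have hH : HasDerivAt (fun x => A x * u₃ x + B x * u₂ x + C x * u₁ x + E * u₀ x)
      (A' r * u₃ r + A r * u₄ r + (B' r * u₂ r + B r * u₃ r) + (C' r * u₁ r + C r * u₂ r) +
        E * u₁ r) r :=
    ((((hA r hr).mul (h3 r hr)).add ((hB r hr).mul (h2 r hr))).add ((hC r hr).mul (h1 r hr))).add
      ((h0 r hr).const_mul E)
  have hzero : HasDerivAt (fun x => A x * u₃ x + B x * u₂ x + C x * u₁ x + E * u₀ x) 0 r := by
    refine (hasDerivAt_const r (0 : ℂ)).congr_of_eventuallyEq ?_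
    filter_upwards [hU.mem_nhds hr] with x hx using hid x hx
  have := hH.unique hzero
  linear_combination this

/-- Derivatives of the Heun coefficients: `P' = 2(ξ+η) + 2 − 2s + 4γ(r − M)`, `Q' = 2γ(1 − 2s)`,
`Δ' = 2(r − M)` (`γ = −iω`). [cite: Costa2019, §3.2.2 (confluent-operator)] -/
theorem hasDerivAt_heun_coeffs (M a s ω m lam : ℝ) (r : ℝ) :
    HasDerivAt (heunP M a s ω m)
        (2 * (horizonExponent M a ω m + innerExponent M a ω m) + 2 - 2 * (s : ℂ) +
          4 * (-I * ω) * ((r - M : ℝ) : ℂ)) r ∧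
      HasDerivAt (heunQ a s ω m lam) (2 * (-I * ω) * (1 - 2 * (s : ℂ))) r := by
  have hsub : ∀ c : ℝ, HasDerivAt (fun x : ℝ => ((x - c : ℝ) : ℂ)) 1 r := fun c => by
    simpa using ((hasDerivAt_id r).sub_const c).ofReal_comp
  have hid' : HasDerivAt (fun x : ℝ => (x : ℂ)) 1 r := by simpa using (hasDerivAt_id r).ofReal_comp
  constructor
  · unfold heunP
    refine ((((hsub (rPlus M a)).const_mul _).add ((hsub (rMinus M a)).const_mul _)).add
      ((hasDerivAt_delta_ofReal M a r).const_mul _)).congr_deriv ?_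
    ring
  · unfold heunQ
    refine (((hid'.const_mul _).sub_const _).sub_const _).congr_deriv ?_
    ring

/-- **The Leibniz family of the confluent Heun equation.** If `g` is smooth on `(r₊, ∞)` and
`Δ g'' + P g' + Q g = 0` there (spin `s`, parameter `λ`), then for every `k`,
`Δ g^{(k+3)} + [P + 2(k+1)(r−M)] g^{(k+2)} + [Q + (k+1)P' + (k+1)k] g^{(k+1)}
+ 2γ(k+1)(k+1−2s) g^{(k)} = 0` (`γ = −iω`): the coefficient of the lowest derivative vanishes
exactly at `k + 1 = 2s`, which is the Teukolsky–Starobinsky mechanism (TdC Lemmas 2.16–2.17 in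
the normalisation `g = heunWeight · R`, `𝒟₀ = e^{−iΘ}∂ᵣe^{iΘ}`).
[cite: Costa2019, Prop. 2.14, Lemmas 2.16–2.17] -/
theorem heun_iterate {M a : ℝ} (s ω m lam : ℝ) {g : ℝ → ℂ}
    (hg : ContDiffOn ℝ ((⊤ : ℕ∞) : WithTop ℕ∞) g (Ioi (rPlus M a)))
    (hH : ∀ r, rPlus M a < r → (delta M a r : ℂ) * (deriv^[2] g) r +
      heunP M a s ω m r * deriv g r + heunQ a s ω m lam r * g r = 0) :
    ∀ (k : ℕ) (r : ℝ), rPlus M a < r →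
      (delta M a r : ℂ) * (deriv^[k + 3] g) r +
        (heunP M a s ω m r + 2 * ((k : ℂ) + 1) * ((r - M : ℝ) : ℂ)) * (deriv^[k + 2] g) r +
        (heunQ a s ω m lam r + ((k : ℂ) + 1) * (2 * (horizonExponent M a ω m + innerExponent M a ω m) +
            2 - 2 * (s : ℂ) + 4 * (-I * ω) * ((r - M : ℝ) : ℂ)) + ((k : ℂ) + 1) * (k : ℂ)) *
          (deriv^[k + 1] g) r +
        (2 * (-I * ω) * ((k : ℂ) + 1) * ((k : ℂ) + 1 - 2 * (s : ℂ))) * (deriv^[k] g) r = 0 := by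
  have hD : ∀ j, ∀ r ∈ Ioi (rPlus M a), HasDerivAt (deriv^[j] g) ((deriv^[j + 1] g) r) r :=
    fun j => (iterate_deriv_smooth isOpen_Ioi hg j).2
  have hΔ : ∀ r ∈ Ioi (rPlus M a), HasDerivAt (fun x => (delta M a x : ℂ)) (2 * ((r - M : ℝ) : ℂ)) r :=
    fun r _ => hasDerivAt_delta_ofReal M a r
  have hsub : ∀ r : ℝ, HasDerivAt (fun x : ℝ => ((x - M : ℝ) : ℂ)) 1 r := fun r => by
    simpa using ((hasDerivAt_id r).sub_const M).ofReal_comp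
  intro k
  induction k with
  | zero =>
    intro r hr
    have h := deriv_identity3 isOpen_Ioi (u₀ := g) (u₁ := deriv g) (u₂ := deriv^[2] g)
      (u₃ := deriv^[3] g) (A := fun x => (delta M a x : ℂ)) (B := heunP M a s ω m) (C := heunQ a s ω m lam)
      (hD 0) (hD 1) (hD 2) hΔ (fun r _ => (hasDerivAt_heun_coeffs M a s ω m lam r).1)
      (fun r _ => (hasDerivAt_heun_coeffs M a s ω m lam r).2) (fun r hr => hH r hr) r hr
    simp only [Nat.cast_zero, zero_add, Function.iterate_one, Function.iterate_zero, id_eq] at h ⊢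
    linear_combination h
  | succ k ih =>
    intro r hr
    have hB : ∀ r ∈ Ioi (rPlus M a), HasDerivAt
        (fun x => heunP M a s ω m x + 2 * ((k : ℂ) + 1) * ((x - M : ℝ) : ℂ))
        ((2 * (horizonExponent M a ω m + innerExponent M a ω m) + 2 - 2 * (s : ℂ) +
          4 * (-I * ω) * ((r - M : ℝ) : ℂ)) + 2 * ((k : ℂ) + 1)) r := by
      intro r _
      exact ((hasDerivAt_heun_coeffs M a s ω m lam r).1.add ((hsub r).const_mul _)).congr_deriv (by ring)
    have hC : ∀ r ∈ Ioi (rPlus M a), HasDerivAt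
        (fun x => heunQ a s ω m lam x + ((k : ℂ) + 1) * (2 * (horizonExponent M a ω m + innerExponent M a ω m) +
            2 - 2 * (s : ℂ) + 4 * (-I * ω) * ((x - M : ℝ) : ℂ)) + ((k : ℂ) + 1) * (k : ℂ))
        (2 * (-I * ω) * (1 - 2 * (s : ℂ)) + ((k : ℂ) + 1) * (4 * (-I * ω))) r := by
      intro r _
      have h1 : HasDerivAt (fun x : ℝ => 2 * (horizonExponent M a ω m + innerExponent M a ω m) +
          2 - 2 * (s : ℂ) + 4 * (-I * ω) * ((x - M : ℝ) : ℂ)) (4 * (-I * ω)) r := by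
        have := ((hsub r).const_mul (4 * (-I * ω))).const_add
          (2 * (horizonExponent M a ω m + innerExponent M a ω m) + 2 - 2 * (s : ℂ))
        simpa using this
      exact (((hasDerivAt_heun_coeffs M a s ω m lam r).2.add (h1.const_mul _)).add_const _).congr_deriv
        (by ring)
    have h := deriv_identity4 isOpen_Ioi (u₀ := deriv^[k] g) (u₁ := deriv^[k + 1] g)
      (u₂ := deriv^[k + 2] g) (u₃ := deriv^[k + 3] g) (u₄ := deriv^[k + 4] g)
      (A := fun x => (delta M a x : ℂ)) (E := 2 * (-I * ω) * ((k : ℂ) + 1) * ((k : ℂ) + 1 - 2 * (s : ℂ)))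
      (hD k) (hD (k + 1)) (hD (k + 2)) (hD (k + 3)) hΔ hB hC (fun r hr => ih r hr) r hr
    push_cast at h ⊢
    simp only [add_assoc, Nat.reduceAdd] at h ⊢
    linear_combination h

/-- **The Teukolsky–Starobinsky map in Heun form.** If `g` solves the spin-`s` Heun equation and
`n = 2s ≥ 1`, then `g^{(n)}` solves the spin-`−s` Heun equation with `λ` replaced by `λ + 2s`:
`Δ (g^{(n)})'' + P_{−s} (g^{(n)})' + Q_{−s,λ+2s} g^{(n)} = 0` (TdC Prop. 2.14 with Lemma 2.16: the
image of a spin-`s` solution under `Δ^s(𝒟₀⁺)^{2s}Δ^s` solves the spin-`−s` equation).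
[cite: Costa2019, Prop. 2.14, Lemmas 2.16–2.17, §4.3] -/
theorem heun_negSpin {M a : ℝ} (hM : 0 < M) (ha : |a| < M) {s : ℝ} (ω m lam : ℝ) {n : ℕ}
    (hn : (n : ℝ) = 2 * s) (hn1 : 1 ≤ n) {g : ℝ → ℂ}
    (hg : ContDiffOn ℝ ((⊤ : ℕ∞) : WithTop ℕ∞) g (Ioi (rPlus M a)))
    (hH : ∀ r, rPlus M a < r → (delta M a r : ℂ) * (deriv^[2] g) r +
      heunP M a s ω m r * deriv g r + heunQ a s ω m lam r * g r = 0) :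
    ∀ r, rPlus M a < r → (delta M a r : ℂ) * (deriv^[n + 2] g) r +
      heunP M a (-s) ω m r * (deriv^[n + 1] g) r + heunQ a (-s) ω m (lam + 2 * s) r * (deriv^[n] g) r = 0 := by
  obtain ⟨k, rfl⟩ : ∃ k, n = k + 1 := ⟨n - 1, by omega⟩
  intro r hr
  have h := heun_iterate s ω m lam hg hH k r hr
  have hk' : (k : ℂ) = 2 * (s : ℂ) - 1 := by
    have : ((k : ℕ) : ℝ) + 1 = 2 * s := by push_cast at hn; linarith
    have : (k : ℝ) = 2 * s - 1 := by linarith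
    exact_mod_cast this
  have hM2 : (M : ℂ) = ((rPlus M a : ℂ) + (rMinus M a : ℂ)) / 2 := by
    rw [← Complex.ofReal_add, rPlus_add_rMinus]; push_cast; ring
  have eP : heunP M a (-s) ω m r = heunP M a s ω m r + 2 * ((k : ℂ) + 1) * ((r - M : ℝ) : ℂ) := by
    unfold heunP; push_cast; rw [hk', hM2]; ring
  have eQ : heunQ a (-s) ω m (lam + 2 * s) r = heunQ a s ω m lam r +
      ((k : ℂ) + 1) * (2 * (horizonExponent M a ω m + innerExponent M a ω m) +
        2 - 2 * (s : ℂ) + 4 * (-I * ω) * ((r - M : ℝ) : ℂ)) + ((k : ℂ) + 1) * (k : ℂ) := by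
    rw [horizonExponent_add_innerExponent hM ha ω m]
    unfold heunQ; push_cast; rw [hk']; ring
  rw [eP, eQ]
  rw [hk'] at h ⊢
  linear_combination h

/-! ### From the Heun form back to the radial ODE -/

/-- **Converse of the Heun form.** If `G` solves `Δ G'' + P_t G' + Q_{t,λ} G = 0` classically on
`(r₊, ∞)`, then `R = heunWeight(t)⁻¹ · G` is a classical solution of the radial Teukolsky ODE of
spin `t` and parameter `λ` (the same two coefficient identities as
`heunEquation_of_isRadialTeukolskySolution`, run backwards). [cite: Costa2019, §3.2.2 (confluent-operator)] -/
theorem isRadialTeukolskySolution_of_heun {M a : ℝ} (hM : 0 < M) (ha : |a| < M) (t ω m lam : ℝ)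
    {G G₁ G₂ : ℝ → ℂ}
    (h : ∀ r, rPlus M a < r → HasDerivAt G (G₁ r) r ∧ HasDerivAt G₁ (G₂ r) r ∧
      (delta M a r : ℂ) * G₂ r + heunP M a t ω m r * G₁ r + heunQ a t ω m lam r * G r = 0) :
    IsRadialTeukolskySolution M a t ω m lam (fun r => (heunWeight M a t ω m r)⁻¹ * G r) := by
  refine ⟨fun r => (heunWeight M a t ω m r)⁻¹ * (G₁ r - heunPsi M a t ω m r * G r),
    fun r => (heunWeight M a t ω m r)⁻¹ * (G₂ r - 2 * heunPsi M a t ω m r * G₁ r +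
      (heunPsi M a t ω m r ^ 2 - heunPsiDeriv M a t ω m r) * G r), fun r hr => ?_⟩
  obtain ⟨hG, hG₁, hode⟩ := h r hr
  have hw0 : heunWeight M a t ω m r ≠ 0 := heunWeight_ne_zero M a t ω m hr
  have hw := hasDerivAt_heunWeight M a t ω m hr
  have hψ := hasDerivAt_heunPsi M a t ω m hr
  have hwinv : HasDerivAt (fun x => (heunWeight M a t ω m x)⁻¹)
      (-(heunPsi M a t ω m r) * (heunWeight M a t ω m r)⁻¹) r := by
    refine (hw.inv hw0).congr_deriv ?_
    field_simp
  have hd1 : HasDerivAt (fun x => (heunWeight M a t ω m x)⁻¹ * G x)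
      ((heunWeight M a t ω m r)⁻¹ * (G₁ r - heunPsi M a t ω m r * G r)) r :=
    (hwinv.mul hG).congr_deriv (by ring)
  have hd2 : HasDerivAt (fun x => (heunWeight M a t ω m x)⁻¹ * (G₁ x - heunPsi M a t ω m x * G x))
      ((heunWeight M a t ω m r)⁻¹ * (G₂ r - 2 * heunPsi M a t ω m r * G₁ r +
        (heunPsi M a t ω m r ^ 2 - heunPsiDeriv M a t ω m r) * G r)) r :=
    (hwinv.mul (hG₁.sub (hψ.mul hG))).congr_deriv (by simp only [Pi.sub_apply, Pi.mul_apply]; ring)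
  refine ⟨hd1, hd2, ?_⟩
  rw [← two_delta_mul_heunPsi_add_heunP hM ha t ω m hr, ← heun_zeroth_order_identity hM ha t ω m lam hr]
  linear_combination (heunWeight M a t ω m r)⁻¹ * hode

/-! ### The horizon condition is preserved -/

/-- **Outgoing at `𝓗⁺` for the image** (TdC Lemma 2.19 / Prop. 2.14 at `r₊`): if `R` is
outgoing at the horizon with spin `s`, then `heunWeight(−s)⁻¹ · (heunWeight(s) R)^{(n)}` is
outgoing at the horizon with spin `−s` (the smooth horizon extension of `g = heunWeight(s) R` is
differentiated `n` times). [cite: Costa2019, Lemma 2.19, Prop. 2.14] -/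
theorem isOutgoingAtHorizon_negSpin_deriv {M a : ℝ} (ha : |a| < M) {s ω m : ℝ} {R : ℝ → ℂ}
    (hH : IsOutgoingAtHorizon M a s ω m R) (n : ℕ) :
    IsOutgoingAtHorizon M a (-s) ω m (fun r => (heunWeight M a (-s) ω m r)⁻¹ *
      (deriv^[n] (fun x => heunWeight M a s ω m x * R x)) r) := by
  obtain ⟨ε₀, hε₀, F, hF, hgF⟩ := heunWeight_mul_smooth_at_horizon ha hH
  have hgap : 0 < rPlus M a - rMinus M a := sub_pos.2 (IsSubextremal.rMinus_lt_rPlus ha)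
  set ε := min ε₀ (rPlus M a - rMinus M a) with hε
  have hεpos : 0 < ε := lt_min hε₀ hgap
  have hεle : ε ≤ ε₀ := min_le_left _ _
  have hεd : ε ≤ rPlus M a - rMinus M a := min_le_right _ _
  have hopen : IsOpen (Ioo (rPlus M a - ε) (rPlus M a + ε)) := isOpen_Ioo
  have hF' : ContDiffOn ℝ ((⊤ : ℕ∞) : WithTop ℕ∞) F (Ioo (rPlus M a - ε) (rPlus M a + ε)) :=
    hF.mono (Ioo_subset_Ioo (by linarith) (by linarith))
  obtain ⟨hFn, -⟩ := iterate_deriv_smooth hopen hF' n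
  have heq : EqOn (deriv^[n] (fun x => heunWeight M a s ω m x * R x)) (deriv^[n] F)
      (Ioo (rPlus M a) (rPlus M a + ε)) :=
    iterate_deriv_eqOn isOpen_Ioo (fun r hr => hgF r ⟨hr.1, by linarith [hr.2]⟩) n
  refine ⟨ε, hεpos, fun r => ((r - rMinus M a : ℝ) : ℂ) ^ (-((((-s : ℝ)) : ℂ) - innerExponent M a ω m)) *
    Complex.exp (-(I * ω * r)) * (deriv^[n] F) r, ?_, fun r hr => ?_⟩
  · refine ContDiffOn.mul (ContDiffOn.mul ?_ ?_) hFn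
    · exact (contDiffOn_ofReal_sub_cpow (rMinus M a) _).mono fun x hx => by
        simp only [mem_Ioi]; linarith [hx.1]
    · exact (Complex.contDiff_exp.comp ((contDiff_const.mul Complex.ofRealCLM.contDiff).neg)).contDiffOn
  · have hr' : rPlus M a < r := hr.1
    have hq : rMinus M a < r := (rMinus_le_rPlus M a).trans_lt hr'
    have hu : ((r - rPlus M a : ℝ) : ℂ) ≠ 0 := by exact_mod_cast (sub_pos.2 hr').ne'
    beta_reduce
    rw [heq hr]
    simp only [heunWeight, mul_inv]
    have e1 : (((r - rMinus M a : ℝ) : ℂ) ^ ((((-s : ℝ)) : ℂ) - innerExponent M a ω m))⁻¹ =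
        ((r - rMinus M a : ℝ) : ℂ) ^ (-((((-s : ℝ)) : ℂ) - innerExponent M a ω m)) :=
      (Complex.cpow_neg _ _).symm
    have e2 : (Complex.exp (I * ω * r))⁻¹ = Complex.exp (-(I * ω * r)) := (Complex.exp_neg _).symm
    have e3 : (((r - rPlus M a : ℝ) : ℂ) ^ ((((-s : ℝ)) : ℂ) - horizonExponent M a ω m))⁻¹ *
        ((r - rPlus M a : ℝ) : ℂ) ^ ((((-s : ℝ)) : ℂ) - horizonExponent M a ω m) = 1 :=
      inv_mul_cancel₀ (fun h0 => hu ((Complex.cpow_eq_zero_iff _ _).1 h0).1)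
    rw [e1, e2]
    linear_combination (((r - rMinus M a : ℝ) : ℂ) ^ (-((((-s : ℝ)) : ℂ) - innerExponent M a ω m)) *
      Complex.exp (-(I * ω * r)) * (deriv^[n] F) r) * e3

/-! ### The outgoing condition at infinity is preserved -/

/-- `heunWeight(−s)⁻¹ · heunWeight(s) = Δⁿ` on `(r₊, ∞)` for `n = 2s`. [folklore] -/
theorem heunWeight_inv_mul_heunWeight {M a : ℝ} (ha : |a| < M) {s : ℝ} (ω m : ℝ) {n : ℕ}
    (hn : (n : ℝ) = 2 * s) {r : ℝ} (hr : rPlus M a < r) :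
    (heunWeight M a (-s) ω m r)⁻¹ * heunWeight M a s ω m r = ((delta M a r : ℝ) : ℂ) ^ n := by
  have hq : rMinus M a < r := (rMinus_le_rPlus M a).trans_lt hr
  have hA : ((r - rMinus M a : ℝ) : ℂ) ≠ 0 := by exact_mod_cast (sub_pos.2 hq).ne'
  have hB : ((r - rPlus M a : ℝ) : ℂ) ≠ 0 := by exact_mod_cast (sub_pos.2 hr).ne'
  have hE : Complex.exp (I * ω * r) ≠ 0 := Complex.exp_ne_zero _
  have hnc : ((n : ℕ) : ℂ) = 2 * (s : ℂ) := by exact_mod_cast hn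
  have e1 : ((r - rMinus M a : ℝ) : ℂ) ^ ((s : ℂ) - innerExponent M a ω m) /
      ((r - rMinus M a : ℝ) : ℂ) ^ ((((-s : ℝ)) : ℂ) - innerExponent M a ω m) =
      ((r - rMinus M a : ℝ) : ℂ) ^ n := by
    rw [← Complex.cpow_sub _ _ hA, ← Complex.cpow_natCast]
    congr 1
    push_cast
    rw [hnc]; ring
  have e2 : ((r - rPlus M a : ℝ) : ℂ) ^ ((s : ℂ) - horizonExponent M a ω m) /
      ((r - rPlus M a : ℝ) : ℂ) ^ ((((-s : ℝ)) : ℂ) - horizonExponent M a ω m) =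
      ((r - rPlus M a : ℝ) : ℂ) ^ n := by
    rw [← Complex.cpow_sub _ _ hB, ← Complex.cpow_natCast]
    congr 1
    push_cast
    rw [hnc]; ring
  have hA' : ((r - rMinus M a : ℝ) : ℂ) ^ ((((-s : ℝ)) : ℂ) - innerExponent M a ω m) ≠ 0 :=
    fun h0 => hA ((Complex.cpow_eq_zero_iff _ _).1 h0).1
  have hB' : ((r - rPlus M a : ℝ) : ℂ) ^ ((((-s : ℝ)) : ℂ) - horizonExponent M a ω m) ≠ 0 :=
    fun h0 => hB ((Complex.cpow_eq_zero_iff _ _).1 h0).1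
  unfold heunWeight
  calc _ = (((r - rMinus M a : ℝ) : ℂ) ^ ((s : ℂ) - innerExponent M a ω m) /
        ((r - rMinus M a : ℝ) : ℂ) ^ ((((-s : ℝ)) : ℂ) - innerExponent M a ω m)) *
      (((r - rPlus M a : ℝ) : ℂ) ^ ((s : ℂ) - horizonExponent M a ω m) /
        ((r - rPlus M a : ℝ) : ℂ) ^ ((((-s : ℝ)) : ℂ) - horizonExponent M a ω m)) := by
        field_simp
    _ = ((delta M a r : ℝ) : ℂ) ^ n := by
        rw [e1, e2, ← mul_pow, delta_eq_mul ha.le]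
        congr 1
        push_cast
        ring

/-- **Outgoing at `𝓘⁺` for the image** (TdC Prop. 2.14 / Lemma 2.19 at `r → ∞`: the image of
`R^{[+s]}_{𝓘⁺}` under the Teukolsky–Starobinsky map is `(2iω)^{2s} R^{[−s]}_{𝓘⁺} + …`). If `R`
(spin `s > 0`, `n = 2s`, `ω ≠ 0`) solves the radial ODE and is outgoing at infinity, then
`R₋ = heunWeight(−s)⁻¹ (heunWeight(s) R)^{(n)} = Δⁿ(ρₙ R + σₙ R')` (ODE-reduced derivative chain
with symbol coefficients) admits the outgoing expansion of spin `−s`: the partial sums of `R`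
are transported explicitly, the remainders by `outgoing_remainder_bounds_allSpin`, and a single
coefficient sequence is extracted by uniqueness of asymptotic coefficients.
[cite: Costa2019, Prop. 2.14, Lemma 2.19, Def. 2.4] -/
theorem isOutgoingAtInfinity_negSpin_deriv {M a : ℝ} (hM : 0 < M) (ha : |a| < M) {s : ℝ}
    (hs : 0 < s) {n : ℕ} (hn : (n : ℝ) = 2 * s) {ω : ℝ} (hω : ω ≠ 0) {m lam : ℝ} {R : ℝ → ℂ}
    (hsol : IsRadialTeukolskySolution M a s ω m lam R) (hI : IsOutgoingAtInfinity M s ω R) :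
    IsOutgoingAtInfinity M (-s) ω (fun r => (heunWeight M a (-s) ω m r)⁻¹ *
      (deriv^[n] (fun x => heunWeight M a s ω m x * R x)) r) := by
  have hrp : 0 < rPlus M a := rPlus_pos hM a
  set r₀ : ℝ := rPlus M a + 1 with hr₀
  have hr₀p : rPlus M a < r₀ := by rw [hr₀]; linarith
  have h0 : 0 < r₀ := hrp.trans hr₀p
  -- the weight and its logarithmic derivative as symbols
  set hw : ℝ → ℂ := heunWeight M a s ω m with hhw
  have hwd : ∀ r, r₀ < r → HasDerivAt hw (hw r * heunPsi M a s ω m r) r := fun r hr =>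
    hasDerivAt_heunWeight M a s ω m (hr₀p.trans hr)
  have hψc : IsInvSmooth r₀ 0 (heunPsi M a s ω m) := by
    have hcp : |rPlus M a| < r₀ := by rw [abs_of_pos hrp]; exact hr₀p
    have hcm : |rMinus M a| < r₀ := by
      rw [abs_of_nonneg (IsSubextremal.rMinus_nonneg ha)]; exact (rMinus_le_rPlus M a).trans_lt hr₀p
    have h1 := ((IsInvSmooth.inv_ofReal_sub h0 hcm).const_mul ((s : ℂ) - innerExponent M a ω m)).mono_degree
      h0 (show (-1 : ℤ) ≤ 0 by norm_num)
    have h2 := ((IsInvSmooth.inv_ofReal_sub h0 hcp).const_mul ((s : ℂ) - horizonExponent M a ω m)).mono_degree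
      h0 (show (-1 : ℤ) ≤ 0 by norm_num)
    refine ((h1.add h2).add (IsInvSmooth.const r₀ (I * ω))).congr fun r _ => ?_
    unfold heunPsi; simp only [div_eq_mul_inv]
  -- the ODE and the chain
  obtain ⟨p, q, hpc, hqc, hpq⟩ := radial_normalForm_symbols hM ha s ω m lam hr₀p
  obtain ⟨R', hRd⟩ := hpq R hsol
  have hderivR : ∀ r, rPlus M a < r → deriv R r = R' r := fun r hr => (hRd r hr).1.deriv
  obtain ⟨ρ, σ, hρ0, hσ0, hcl, hder⟩ := exists_odeChain h0 hwd hψc hpc hqc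
    (fun r hr => (hRd r (hr₀p.trans hr)).1) (fun r hr => (hRd r (hr₀p.trans hr)).2)
    (IsInvSmooth.const r₀ 1) (IsInvSmooth.zero r₀ 0) n
  set f : ℕ → ℝ → ℂ := fun j r => hw r * (ρ j r * R r + σ j r * R' r) with hf
  set g : ℝ → ℂ := fun x => heunWeight M a s ω m x * R x with hg
  have hGf : ∀ j, j ≤ n → ∀ x, r₀ < x → (deriv^[j] g) x = f j x := by
    intro j
    induction j with
    | zero => intro _ x _; simp only [hf, hg, hρ0, hσ0, Function.iterate_zero, id_eq, hhw]; ring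
    | succ j ih =>
      intro hj x hx
      have hj' : j < n := Nat.lt_of_succ_le hj
      rw [Function.iterate_succ_apply']
      have hloc : deriv^[j] g =ᶠ[𝓝 x] f j := by
        filter_upwards [Ioi_mem_nhds hx] with y hy using ih hj'.le y hy
      rw [hloc.deriv_eq]
      exact (hder j hj' x hx).deriv
  -- `R₋ = Δⁿ (ρₙ R + σₙ R')` beyond `r₀`
  have hRm : ∀ x, r₀ < x → (heunWeight M a (-s) ω m x)⁻¹ * (deriv^[n] g) x =
      ((delta M a x : ℝ) : ℂ) ^ n * (ρ n x * R x + σ n x * R' x) := by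
    intro x hx
    rw [hGf n le_rfl x hx]
    simp only [hf, hhw]
    rw [← mul_assoc, heunWeight_inv_mul_heunWeight ha ω m hn (hr₀p.trans hx)]
  -- symbols
  obtain ⟨hρn, hσn⟩ := hcl n le_rfl
  have hΔc : IsInvSmooth r₀ 2 (fun r => ((delta M a r : ℝ) : ℂ)) :=
    (((IsInvSmooth.ofReal_sub_const h0 (rPlus M a)).mul h0
      (IsInvSmooth.ofReal_sub_const h0 (rMinus M a))).cast_degree (by norm_num)).congr fun r _ => by
        rw [delta_eq_mul ha.le]; push_cast; ring
  have hΔn : IsInvSmooth r₀ (n * 2) (fun r => ((delta M a r : ℝ) : ℂ) ^ n) := hΔc.pow h0 n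
  have h𝒜 : IsInvSmooth r₀ ((n : ℤ) * 2) (fun r => ((delta M a r : ℝ) : ℂ) ^ n * ρ n r) :=
    (hΔn.mul h0 hρn).cast_degree (by ring)
  have hℬ : IsInvSmooth r₀ ((n : ℤ) * 2) (fun r => ((delta M a r : ℝ) : ℂ) ^ n * σ n r) :=
    (hΔn.mul h0 hσn).cast_degree (by ring)
  obtain ⟨Cρ, hCρ⟩ := hρn.norm_le h0
  obtain ⟨Cσ, hCσ⟩ := hσn.norm_le h0
  -- the outgoing expansion of `R` and its remainders
  obtain ⟨c, hc⟩ := hI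
  obtain ⟨K₀, hK₀, hrem⟩ := outgoing_remainder_bounds_allSpin hM ha hω hsol (c := c) hc
  have hk₀ : 2 * s = ((n : ℤ) : ℝ) := by push_cast; linarith
  set θ : ℝ → ℂ := fun r => I * ω + 2 * I * M * ω * (r : ℂ)⁻¹ with hθ
  have hθc : IsInvSmooth r₀ 0 θ := by
    have := (IsInvSmooth.const r₀ (I * ω)).add
      (((IsInvSmooth.zpow r₀ (-1)).const_mul (2 * I * M * ω)).mono_degree h0 (by norm_num))
    refine this.congr fun r _ => ?_
    simp only [hθ, zpow_neg, zpow_one]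
  -- size of `Δⁿ`
  have hΔb : ∀ r, rPlus M a < r → ‖((delta M a r : ℝ) : ℂ) ^ n‖ ≤ (2 : ℝ) ^ n * r ^ (2 * n) := by
    intro r hr
    have hr0 : 0 < r := hrp.trans hr
    have har : |a| ≤ r := (le_of_lt ha).trans ((M_le_rPlus M a).trans hr.le)
    have h1 := delta_le_two_sq hM.le hr0.le har
    have h2 : 0 ≤ delta M a r := (delta_pos ha.le hr).le
    rw [norm_pow, Complex.norm_real, Real.norm_eq_abs, abs_of_nonneg h2, pow_mul, ← mul_pow]
    exact pow_le_pow_left₀ h2 (by nlinarith) n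
  -- expansions of `R₋` to every order, with order-dependent coefficients
  have hexpJ : ∀ J : ℕ, ∃ (b : ℕ → ℂ) (C X : ℝ), ∀ r, X ≤ r →
      ‖(heunWeight M a (-s) ω m r)⁻¹ * (deriv^[n] g) r -
        outgoingPhase M ω r * ∑ k ∈ Finset.range (J + 1), b k * (r : ℂ) ^ (((n : ℤ) - 1) - k)‖ ≤
      C * r ^ (((n : ℤ) - 1) - J - 1 : ℤ) := by
    intro J
    set N : ℕ := 2 * J + n + ⌈K₀⌉₊ + 3 with hN
    have hN1 : 1 ≤ N := by omega
    have hNR : 2 * J + n + K₀ + 3 ≤ (N : ℝ) := by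
      have h1 : K₀ ≤ (⌈K₀⌉₊ : ℝ) := Nat.le_ceil _
      rw [hN]; push_cast; linarith
    have hNs : -(2 * s) ≤ (N : ℝ) := by
      have : (0 : ℝ) ≤ N := Nat.cast_nonneg N
      linarith
    obtain ⟨XN, CN, hXN, hXN1, hEN⟩ := hrem N hN1 hNs
    set e₁ : ℝ := -(2 * s) - (N : ℝ) - 2 with he₁
    set e₂ : ℝ := (-(2 * s) - (N : ℝ) - 2 + K₀) / 2 with he₂
    have he₁le : (2 * n : ℕ) + e₁ ≤ ((((n : ℤ) - 1) - J - 1 : ℤ) : ℝ) := by push_cast; rw [he₁]; linarith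
    have he₂le : (2 * n : ℕ) + e₂ ≤ ((((n : ℤ) - 1) - J - 1 : ℤ) : ℝ) := by push_cast; rw [he₂]; linarith
    -- the main symbol
    obtain ⟨hπ, hπ'⟩ := isInvSmooth_outgoingSum h0 hk₀ c N
    have hπ₁ : IsInvSmooth r₀ (-(n : ℤ) - 1) (outgoingSumDeriv s c N) := hπ'.mono_degree h0 (by omega)
    have hin : IsInvSmooth r₀ (-(n : ℤ) - 1)
        (fun r => θ r * outgoingSum s c N r + outgoingSumDeriv s c N r) :=
      ((hθc.mul h0 hπ).cast_degree (by ring)).add hπ₁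
    set mN : ℝ → ℂ := fun r => ((delta M a r : ℝ) : ℂ) ^ n * ρ n r * outgoingSum s c N r +
      ((delta M a r : ℝ) : ℂ) ^ n * σ n r * (θ r * outgoingSum s c N r + outgoingSumDeriv s c N r) with hmN
    have hmNc : IsInvSmooth r₀ ((n : ℤ) - 1) mN :=
      (((h𝒜.mul h0 hπ).add (hℬ.mul h0 hin)).cast_degree (by ring)).congr fun r _ => by simp only [hmN]
    obtain ⟨bN, hbN⟩ := hmNc.expansion' h0
    obtain ⟨Cm, hCm⟩ := hbN J
    -- the estimate
    set X : ℝ := max XN (r₀ + 1) with hX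
    refine ⟨bN, Cm + (2 : ℝ) ^ n * |CN| * (|Cρ| + |Cσ|), X, fun r hr => ?_⟩
    have hrN : XN ≤ r := (le_max_left _ _).trans hr
    have hrr₀ : r₀ < r := by have := (le_max_right _ _).trans hr; linarith
    have hrp' : rPlus M a < r := hr₀p.trans hrr₀
    have hr1 : 1 ≤ r := hXN1.trans hrN
    have hr0 : 0 < r := by linarith
    obtain ⟨hE, hE'⟩ := hEN r hrN
    rw [hderivR r hrp'] at hE'
    -- `R₋ − Φ₀ m_N = Δⁿ (ρₙ E_N + σₙ E_N')`
    have hsplit : (heunWeight M a (-s) ω m r)⁻¹ * (deriv^[n] g) r - outgoingPhase M ω r * mN r =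
        ((delta M a r : ℝ) : ℂ) ^ n * (ρ n r * (R r - outgoingP M s ω c N r) +
          σ n r * (R' r - outgoingPDeriv M s ω c N r)) := by
      rw [hRm r hrr₀]
      simp only [hmN, hθ, outgoingP, outgoingPDeriv]
      ring
    have e : (heunWeight M a (-s) ω m r)⁻¹ * (deriv^[n] g) r -
        outgoingPhase M ω r * ∑ k ∈ Finset.range (J + 1), bN k * (r : ℂ) ^ (((n : ℤ) - 1) - k) =
        ((heunWeight M a (-s) ω m r)⁻¹ * (deriv^[n] g) r - outgoingPhase M ω r * mN r) +
          outgoingPhase M ω r * (mN r - ∑ k ∈ Finset.range (J + 1), bN k * (r : ℂ) ^ (((n : ℤ) - 1) - k)) := by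
      ring
    rw [e, hsplit]
    have hzD : 0 ≤ r ^ (2 * n) := pow_nonneg hr0.le _
    have hρb : ‖ρ n r‖ ≤ |Cρ| := by
      have := hCρ r hrr₀; rw [zpow_zero, mul_one] at this; exact this.trans (le_abs_self _)
    have hσb : ‖σ n r‖ ≤ |Cσ| := by
      have := hCσ r hrr₀; rw [zpow_zero, mul_one] at this; exact this.trans (le_abs_self _)
    have hEb : ‖R r - outgoingP M s ω c N r‖ ≤ |CN| * r ^ e₁ :=
      hE.trans (mul_le_mul_of_nonneg_right (le_abs_self _) (Real.rpow_nonneg hr0.le _))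
    have hE'b : ‖R' r - outgoingPDeriv M s ω c N r‖ ≤ |CN| * r ^ e₂ :=
      hE'.trans (mul_le_mul_of_nonneg_right (le_abs_self _) (Real.rpow_nonneg hr0.le _))
    have key : ∀ e' : ℝ, ((2 * n : ℕ) : ℝ) + e' ≤ ((((n : ℤ) - 1) - J - 1 : ℤ) : ℝ) →
        r ^ (2 * n) * r ^ e' ≤ r ^ (((n : ℤ) - 1) - J - 1 : ℤ) := by
      intro e' he'
      calc r ^ (2 * n) * r ^ e' = r ^ ((2 * n : ℕ) : ℝ) * r ^ e' := by rw [Real.rpow_natCast]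
        _ = r ^ (((2 * n : ℕ) : ℝ) + e') := (Real.rpow_add hr0 _ _).symm
        _ ≤ r ^ ((((n : ℤ) - 1) - J - 1 : ℤ) : ℝ) := Real.rpow_le_rpow_of_exponent_le hr1 he'
        _ = r ^ (((n : ℤ) - 1) - J - 1 : ℤ) := Real.rpow_intCast r _
    have hΦ1 : ‖outgoingPhase M ω r‖ = 1 := norm_outgoingPhase M ω r
    calc ‖((delta M a r : ℝ) : ℂ) ^ n * (ρ n r * (R r - outgoingP M s ω c N r) +
          σ n r * (R' r - outgoingPDeriv M s ω c N r)) +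
        outgoingPhase M ω r * (mN r - ∑ k ∈ Finset.range (J + 1), bN k * (r : ℂ) ^ (((n : ℤ) - 1) - k))‖ ≤
        ‖((delta M a r : ℝ) : ℂ) ^ n‖ * (‖ρ n r‖ * ‖R r - outgoingP M s ω c N r‖ +
          ‖σ n r‖ * ‖R' r - outgoingPDeriv M s ω c N r‖) +
        ‖mN r - ∑ k ∈ Finset.range (J + 1), bN k * (r : ℂ) ^ (((n : ℤ) - 1) - k)‖ := by
          refine (norm_add_le _ _).trans (add_le_add ?_ ?_)
          · rw [norm_mul]
            refine mul_le_mul_of_nonneg_left ((norm_add_le _ _).trans ?_) (norm_nonneg _)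
            rw [norm_mul, norm_mul]
          · rw [norm_mul, hΦ1, one_mul]
      _ ≤ ((2 : ℝ) ^ n * r ^ (2 * n)) * (|Cρ| * (|CN| * r ^ e₁) + |Cσ| * (|CN| * r ^ e₂)) +
          Cm * r ^ (((n : ℤ) - 1) - J - 1 : ℤ) := by
          refine add_le_add (mul_le_mul (hΔb r hrp') (add_le_add
            (mul_le_mul hρb hEb (norm_nonneg _) (abs_nonneg _))
            (mul_le_mul hσb hE'b (norm_nonneg _) (abs_nonneg _))) (by positivity) (by positivity))
            (hCm r hrr₀)
      _ = (2 : ℝ) ^ n * |CN| * (|Cρ| * (r ^ (2 * n) * r ^ e₁) + |Cσ| * (r ^ (2 * n) * r ^ e₂)) +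
          Cm * r ^ (((n : ℤ) - 1) - J - 1 : ℤ) := by ring
      _ ≤ (2 : ℝ) ^ n * |CN| * (|Cρ| * r ^ (((n : ℤ) - 1) - J - 1 : ℤ) + |Cσ| * r ^ (((n : ℤ) - 1) - J - 1 : ℤ)) +
          Cm * r ^ (((n : ℤ) - 1) - J - 1 : ℤ) := by
          refine add_le_add (mul_le_mul_of_nonneg_left (add_le_add
            (mul_le_mul_of_nonneg_left (key e₁ he₁le) (abs_nonneg _))
            (mul_le_mul_of_nonneg_left (key e₂ he₂le) (abs_nonneg _))) (by positivity)) le_rfl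
      _ = (Cm + (2 : ℝ) ^ n * |CN| * (|Cρ| + |Cσ|)) * r ^ (((n : ℤ) - 1) - J - 1 : ℤ) := by ring
  -- one coefficient sequence for all orders
  obtain ⟨c', hc'⟩ := exists_uniform_coeffs (F := fun r => (heunWeight M a (-s) ω m r)⁻¹ * (deriv^[n] g) r)
    (Φ₀ := outgoingPhase M ω) (norm_outgoingPhase M ω) hexpJ
  -- conclusion, in the format of `Kerr.IsOutgoingAtInfinity`
  refine ⟨c', fun N _ => ?_⟩
  obtain ⟨C, X, hCX⟩ := hc' N
  refine ⟨C, max X 1, fun r hr => ?_⟩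
  have hr1 : 1 ≤ r := (le_max_right _ _).trans hr
  have hcast : ∀ k : ℕ, ((r ^ (-(2 * -s) - (k : ℝ) - 1) : ℝ) : ℂ) = (r : ℂ) ^ (((n : ℤ) - 1) - k) := by
    intro k
    rw [show (-(2 * -s) - (k : ℝ) - 1 : ℝ) = ((((n : ℤ) - 1) - (k : ℤ) : ℤ) : ℝ) by push_cast; linarith,
      Real.rpow_intCast, Complex.ofReal_zpow]
  have hrhs : r ^ (-(2 * -s) - (N : ℝ) - 2) = r ^ ((((n : ℤ) - 1) - N - 1 : ℤ)) := by
    rw [show (-(2 * -s) - (N : ℝ) - 2 : ℝ) = ((((n : ℤ) - 1) - N - 1 : ℤ) : ℝ) by push_cast; linarith,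
      Real.rpow_intCast]
  simp only [hcast]
  rw [hrhs]
  exact hCX r ((le_max_left _ _).trans hr)

/-! ### Decay of `g = heunWeight · R` at infinity for `s > 0` -/

/-- For `s ≥ 0` and `R` outgoing at infinity, `g = heunWeight(s) · R → 0` as `r → ∞`
(`|heunWeight| = (r−r₋)^s (r−r₊)^s ≤ r^{2s}` and `|R| ≲ r^{−2s−1}`). [cite: Costa2019, Def. 2.4] -/
theorem tendsto_heunWeight_mul_zero {M a : ℝ} (hM : 0 < M) (ha : |a| < M) {s : ℝ} (hs : 0 ≤ s)
    (ω m : ℝ) {R : ℝ → ℂ} (hI : IsOutgoingAtInfinity M s ω R) :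
    Tendsto (fun r => heunWeight M a s ω m r * R r) atTop (𝓝 0) := by
  have hrp : 0 < rPlus M a := rPlus_pos hM a
  have hrm : 0 ≤ rMinus M a := IsSubextremal.rMinus_nonneg ha
  obtain ⟨c, hc⟩ := hI
  obtain ⟨C, r₀, hCr⟩ := hc 1 le_rfl
  set K : ℝ := ‖c 0‖ + ‖c 1‖ + |C| with hK
  have hbound : ∀ r, max (max r₀ 1) (rPlus M a + 1) ≤ r →
      ‖heunWeight M a s ω m r * R r‖ ≤ K * r⁻¹ := by
    intro r hr
    have hr1 : 1 ≤ r := ((le_max_right _ _).trans (le_max_left _ _)).trans hr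
    have hr0 : 0 < r := by linarith
    have hrr₀ : r₀ ≤ r := ((le_max_left _ _).trans (le_max_left _ _)).trans hr
    have hrp' : rPlus M a < r := by have := (le_max_right _ _).trans hr; linarith
    have hq : rMinus M a < r := (rMinus_le_rPlus M a).trans_lt hrp'
    -- `|R| ≤ K r^{−2s−1}`
    have h1 := hCr r hrr₀
    have hR : ‖R r‖ ≤ K * r ^ (-(2 * s) - 1) := by
      have hsum : ‖Complex.exp (I * ω * r + 2 * I * M * ω * Real.log r) *
          ∑ k ∈ Finset.range (1 + 1), c k * ((r ^ (-(2 * s) - (k : ℝ) - 1) : ℝ) : ℂ)‖ ≤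
          (‖c 0‖ + ‖c 1‖) * r ^ (-(2 * s) - 1) := by
        rw [norm_mul, norm_exp_outgoingPhase M ω r, one_mul, Finset.sum_range_succ, Finset.sum_range_one]
        refine (norm_add_le _ _).trans ?_
        rw [norm_mul, norm_mul, Complex.norm_real, Complex.norm_real, Real.norm_eq_abs, Real.norm_eq_abs,
          abs_of_nonneg (Real.rpow_nonneg hr0.le _), abs_of_nonneg (Real.rpow_nonneg hr0.le _)]
        have e0 : r ^ (-(2 * s) - ((0 : ℕ) : ℝ) - 1) = r ^ (-(2 * s) - 1) := by norm_num
        have e1 : r ^ (-(2 * s) - ((1 : ℕ) : ℝ) - 1) ≤ r ^ (-(2 * s) - 1) :=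
          Real.rpow_le_rpow_of_exponent_le hr1 (by norm_num)
        rw [e0]
        nlinarith [norm_nonneg (c 0), norm_nonneg (c 1), Real.rpow_nonneg hr0.le (-(2 * s) - 1)]
      have hrem : C * r ^ (-(2 * s) - ((1 : ℕ) : ℝ) - 2) ≤ |C| * r ^ (-(2 * s) - 1) :=
        (mul_le_mul_of_nonneg_right (le_abs_self C) (Real.rpow_nonneg hr0.le _)).trans
          (mul_le_mul_of_nonneg_left (Real.rpow_le_rpow_of_exponent_le hr1 (by norm_num)) (abs_nonneg C))
      calc ‖R r‖ = ‖(R r - Complex.exp (I * ω * r + 2 * I * M * ω * Real.log r) *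
            ∑ k ∈ Finset.range (1 + 1), c k * ((r ^ (-(2 * s) - (k : ℝ) - 1) : ℝ) : ℂ)) +
            Complex.exp (I * ω * r + 2 * I * M * ω * Real.log r) *
              ∑ k ∈ Finset.range (1 + 1), c k * ((r ^ (-(2 * s) - (k : ℝ) - 1) : ℝ) : ℂ)‖ := by
              rw [sub_add_cancel]
        _ ≤ C * r ^ (-(2 * s) - ((1 : ℕ) : ℝ) - 2) + (‖c 0‖ + ‖c 1‖) * r ^ (-(2 * s) - 1) :=
              (norm_add_le _ _).trans (add_le_add h1 hsum)
        _ ≤ |C| * r ^ (-(2 * s) - 1) + (‖c 0‖ + ‖c 1‖) * r ^ (-(2 * s) - 1) := add_le_add hrem le_rfl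
        _ = K * r ^ (-(2 * s) - 1) := by rw [hK]; ring
    -- `|heunWeight| ≤ r^{2s}`
    have hw : ‖heunWeight M a s ω m r‖ ≤ r ^ (2 * s) := by
      rw [norm_heunWeight M a s ω m hrp']
      have h1 : (r - rMinus M a) ^ s ≤ r ^ s := Real.rpow_le_rpow (sub_pos.2 hq).le (by linarith) hs
      have h2 : (r - rPlus M a) ^ s ≤ r ^ s := Real.rpow_le_rpow (sub_pos.2 hrp').le (by linarith) hs
      calc (r - rMinus M a) ^ s * (r - rPlus M a) ^ s ≤ r ^ s * r ^ s :=
            mul_le_mul h1 h2 (Real.rpow_nonneg (sub_pos.2 hrp').le _) (Real.rpow_nonneg hr0.le _)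
        _ = r ^ (2 * s) := by rw [← Real.rpow_add hr0]; ring_nf
    have hK0 : 0 ≤ K := by rw [hK]; positivity
    calc ‖heunWeight M a s ω m r * R r‖ = ‖heunWeight M a s ω m r‖ * ‖R r‖ := norm_mul _ _
      _ ≤ r ^ (2 * s) * (K * r ^ (-(2 * s) - 1)) :=
          mul_le_mul hw hR (norm_nonneg _) (Real.rpow_nonneg hr0.le _)
      _ = K * (r ^ (2 * s) * r ^ (-(2 * s) - 1)) := by ring
      _ = K * r⁻¹ := by rw [← Real.rpow_add hr0, show 2 * s + (-(2 * s) - 1) = (-1 : ℝ) by ring, Real.rpow_neg_one]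
  have hlim : Tendsto (fun r : ℝ => K * r⁻¹) atTop (𝓝 0) := by
    have := (tendsto_inv_atTop_zero (𝕜 := ℝ)).const_mul K
    simpa using this
  refine squeeze_zero_norm' ?_ hlim
  exact Filter.eventually_atTop.2 ⟨_, fun r hr => hbound r hr⟩

/-! ### Mode stability for `s > 0` from mode stability for `−s` -/

/-- **Teixeira da Costa §4.3** ("mode stability for `s > 0` follows from the mode stability for
`s < 0` via the Teukolsky–Starobinsky identities"): let `s > 0`, `n = 2s ∈ ℕ`, `ω ≠ 0` real,
`|a| < M`, and suppose every classical solution of the spin-`−s` radial ODE with parameter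
`λ + 2s` which is outgoing at `𝓗⁺` and `𝓘⁺` vanishes. Then every classical solution `R` of the
spin-`s` radial ODE with parameter `λ` which is outgoing at `𝓗⁺` and `𝓘⁺` vanishes: its image
`R₋ = heunWeight(−s)⁻¹ (heunWeight(s) R)^{(2s)}` is such a spin-`−s` solution, so
`(heunWeight(s) R)^{(2s)} ≡ 0`, and `heunWeight(s) R → 0` at infinity forces
`heunWeight(s) R ≡ 0`. [cite: Costa2019, §4.3, Prop. 2.14, Lemma 2.19] -/
theorem modeStability_pos_of_nonpos {M a : ℝ} (hM : 0 < M) (ha : |a| < M) {s : ℝ} (hs : 0 < s)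
    {n : ℕ} (hn : (n : ℝ) = 2 * s) {ω : ℝ} (hω : ω ≠ 0) (m lam : ℝ) {R : ℝ → ℂ}
    (hsol : IsRadialTeukolskySolution M a s ω m lam R) (hH : IsOutgoingAtHorizon M a s ω m R)
    (hI : IsOutgoingAtInfinity M s ω R)
    (hneg : ∀ Q : ℝ → ℂ, IsRadialTeukolskySolution M a (-s) ω m (lam + 2 * s) Q →
      IsOutgoingAtHorizon M a (-s) ω m Q → IsOutgoingAtInfinity M (-s) ω Q →
      ∀ r, rPlus M a < r → Q r = 0) :
    ∀ r, rPlus M a < r → R r = 0 := by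
  have hn1 : 1 ≤ n := by
    have : (0 : ℝ) < n := by rw [hn]; linarith
    exact_mod_cast Nat.one_le_iff_ne_zero.2 (by rintro rfl; simp at this)
  set g : ℝ → ℂ := fun x => heunWeight M a s ω m x * R x with hg
  -- `g` is smooth on `(r₊, ∞)`
  have hRs : ContDiffOn ℝ ((⊤ : ℕ∞) : WithTop ℕ∞) R (Ioi (rPlus M a)) :=
    contDiffOn_of_isRadialTeukolskySolution ha.le hsol
  have hws : ContDiffOn ℝ ((⊤ : ℕ∞) : WithTop ℕ∞) (heunWeight M a s ω m) (Ioi (rPlus M a)) := by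
    unfold heunWeight
    refine ContDiffOn.mul (ContDiffOn.mul ?_ ?_) ?_
    · exact (contDiffOn_ofReal_sub_cpow (rMinus M a) _).mono fun x hx =>
        show rMinus M a < x from (rMinus_le_rPlus M a).trans_lt hx
    · exact contDiffOn_ofReal_sub_cpow (rPlus M a) _
    · exact (Complex.contDiff_exp.comp (contDiff_const.mul Complex.ofRealCLM.contDiff)).contDiffOn
  have hgs : ContDiffOn ℝ ((⊤ : ℕ∞) : WithTop ℕ∞) g (Ioi (rPlus M a)) := hws.mul hRs
  -- the Heun equation for `g` in terms of `deriv`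
  obtain ⟨g₁, g₂, hge⟩ := heunEquation_of_isRadialTeukolskySolution hM ha hsol
  have hd1 : ∀ r, rPlus M a < r → deriv g r = g₁ r := fun r hr => (hge r hr).1.deriv
  have hd2 : ∀ r, rPlus M a < r → (deriv^[2] g) r = g₂ r := by
    intro r hr
    rw [Function.iterate_succ_apply', Function.iterate_one]
    have hloc : deriv g =ᶠ[𝓝 r] g₁ := by
      filter_upwards [Ioi_mem_nhds hr] with x hx using hd1 x hx
    rw [hloc.deriv_eq]
    exact (hge r hr).2.1.deriv
  have hHeun : ∀ r, rPlus M a < r → (delta M a r : ℂ) * (deriv^[2] g) r +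
      heunP M a s ω m r * deriv g r + heunQ a s ω m lam r * g r = 0 := by
    intro r hr
    rw [hd2 r hr, hd1 r hr]
    exact (hge r hr).2.2
  -- the image `R₋` is a spin `−s` outgoing solution
  have hsolm : IsRadialTeukolskySolution M a (-s) ω m (lam + 2 * s)
      (fun r => (heunWeight M a (-s) ω m r)⁻¹ * (deriv^[n] g) r) :=
    isRadialTeukolskySolution_of_heun hM ha (-s) ω m (lam + 2 * s) (G := deriv^[n] g)
      (G₁ := deriv^[n + 1] g) (G₂ := deriv^[n + 2] g) fun r hr =>
        ⟨(iterate_deriv_smooth isOpen_Ioi hgs n).2 r hr,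
          (iterate_deriv_smooth isOpen_Ioi hgs (n + 1)).2 r hr,
          heun_negSpin hM ha ω m lam hn hn1 hgs hHeun r hr⟩
  have hHm : IsOutgoingAtHorizon M a (-s) ω m (fun r => (heunWeight M a (-s) ω m r)⁻¹ * (deriv^[n] g) r) :=
    isOutgoingAtHorizon_negSpin_deriv ha hH n
  have hIm : IsOutgoingAtInfinity M (-s) ω (fun r => (heunWeight M a (-s) ω m r)⁻¹ * (deriv^[n] g) r) :=
    isOutgoingAtInfinity_negSpin_deriv hM ha hs hn hω hsol hI
  have hzero := hneg _ hsolm hHm hIm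
  -- hence `g^{(n)} ≡ 0`, and `g → 0` at infinity, so `g ≡ 0`
  have hDn : ∀ r, rPlus M a < r → (deriv^[n] g) r = 0 := by
    intro r hr
    have h1 := hzero r hr
    rcases mul_eq_zero.1 h1 with h2 | h2
    · exact absurd h2 (inv_ne_zero (heunWeight_ne_zero M a (-s) ω m hr))
    · exact h2
  have hlim : Tendsto g atTop (𝓝 0) := tendsto_heunWeight_mul_zero hM ha hs.le ω m hI
  have hg0 := eq_zero_of_iterate_deriv_eq_zero n hgs hDn hlim
  intro r hr
  have h1 := hg0 r hr
  rcases mul_eq_zero.1 h1 with h2 | h2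
  · exact absurd h2 (heunWeight_ne_zero M a s ω m hr)
  · exact h2

end Costa2019

end Literature.Geometry.Lorentzian.Kerr

end
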